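/-
Copyright (c) 2026. Released under the Apache 2.0 license.
-/
import Literature.NumberTheory.EllipticCurves.ManinConstantQuadraticTwistLevelBoundProofs
import Literature.NumberTheory.EllipticCurves.ManinConstantConductorLt500000
import HarnessLib

/-!
# `|c₀(𝒜)| = 1` by twist-descent to Cremona's DETERMINED range — the generic level-bounded road of
# `ManinConstantQuadraticTwistLevelBoundProofs.lean` INSTANTIATED at `B = 400000` (named input
# `h40`) and at the refereed-secondary bound `B = 300000` (`h30`); at `B = 130000` (`h26`) it is the
# booked road. The `400000` instance reaches Kodaira type `I_ν*` at `3` for `390000 < N < 500000`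
# (twist partner at level `N/3 ∈ (130000, 166667]`)

[Proofs] Theorems only (no definition, no named fact; D-0026). Topic
`Literature/NumberTheory/EllipticCurves`; namespace `Literature.NumberTheory.EllipticCurves.ModularForms`.

`ManinConstantQuadraticTwistCremonaRangeProofs.lean` (the booked road T-TWIST-CRE, referee A
ROUNDS 489 / 492) reads the `Γ₀` twist step `c₀(𝒜) ∣ c(D')` (`maninConstant_dvd_of_charTwist_gamma0`)
GLOBALLY against ONE level-bounded Manin datum: Agashe–Ribet–Stein 2006 Thm. 2.6 (`h26`, Cremona:
`c = 1` for every optimal curve of conductor `≤ 130000`) at the partner class `𝒜'` (`𝒜 = 𝒜' ⊗ χ_{q*}`,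
`𝒜'` semistable at the odd `q`). The partner's conductor is `N/q²` (type `I₀*` at `q`) or `N/q`
(type `I_ν*`, `ν ≥ 1`); with the bound `130000` the `I_ν*` key at `q = 3` therefore stops at
`N ≤ 390000` — on Cremona's table (`N < 500000`) the classes of type `I_ν*` at `3` with
`N > 390000` (partner level `N/3 ∈ (130000, 166667]`) are exactly what that road cannot reach.
`ManinConstantQuadraticTwistLevelBoundProofs.lean` re-proves that road with the level bound a
PARAMETER `B` and the fact `h26` replaced by a displayed hypothesis `hB` of the common SHAPE of the
tree's level-bounded Manin data. THIS FILE instantiates `hB`: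

* at `B = 400000` with `h40 = cremona_abs_maninConstant_eq_one_of_level_le_400000`
  (`ManinConstantConductorLt500000.lean`): Cremona's DETERMINED range — optimality code `1` and
  Manin constant `1` on the optimal curve of EVERY class of conductor `≤ 400000` (`ecdata/manin.txt`
  ¶1–2, ¶ "Concerning the Manin constant", data `opt_man`), the NAMED INPUT of record (referee A
  ROUND 325 «α with named dependency»; DATUM grade);
* at `B = 300000` with `h30 = cremona_abs_maninConstant_eq_one_of_level_le_300000`
  (`ManinConstantConductorLe300000.lean`): the refereed-secondary sentence of
  Česnavičius–Neururer–Saha 2024 §1 citing the database ([Cre19]);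
* (at `B = 130000` with `h26 = AgasheRibetStein2006.cremona_abs_maninConstant_eq_one_of_level_le`,
  PUB, the generic certificate IS the booked one — identified by the gate's dedup lint, not restated).

WHAT THE `B = 400000` INSTANCE CONSUMES, EXACTLY. For a class `𝒜` (any conductor, any optimality
code) every globally minimal member of which is `V^{(q*)}` for a curve `V` semistable at the odd `q`
(displayed by the Kodaira symbol `Iₙ*` at `q`, or by the tree's witness `TwistSemistableWitnessAt`),
the optimal `X₀`-datum `D'` of the PARTNER class (produced by modularity, `hnf`) lives at level
`N(𝒜') = N/q` or `N/q²`; the datum `h40` is applied to THAT datum at THAT level (`≤ 400000`), where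
Cremona's optimal curve is DETERMINED (code `1`) — the same datum, at the same kind of level, that
every code-`1` level-I row of the census cites by name (referee A ROUNDS 317.3 (α″) «one datum, one
tier», 325). The class `𝒜` itself may be of optimality code `≥ 2`: the theorem quantifies over EVERY
globally minimal member (whichever is optimal) and never reads `𝒜`'s own database line (referee A
ROUND 317.3 (γ″)'s objection — «`mc = 1` is the conditional constant of a curve that may not be the
optimal one» — concerns `𝒜`'s line, not `𝒜'`'s). Tier words are the referee's; this file books nothing.

Statements (binders `h40 hnf`, resp. `h30 hnf`, `h26 hnf`; no `hM hAU hC2`):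
* `classAbsManinConstantEqOne_of_forall_exists_kodairaIstar_or_twist_of_level_le_400000 (h40 hnf) W hcov`
  — every globally minimal member `W'` has an odd prime `p` with (`I₀*` at `p` ∧ `N(W') ≤ 400000·p²`)
  ∨ (`I_ν*`, `ν ≥ 1`, at `p` ∧ `N(W') ≤ 400000·p`) ∨ (`TwistSemistableWitnessAt W' p` ∧
  `N(W') ≤ 400000·p`) ⟹ `ClassAbsManinConstantEqOne W`; Kodaira-only form
  `…_kodairaIstar_of_level_le_400000`; binder forms `not_dvd_…_400000`, `padicValInt_…_400000`.
* the TABLE form on Cremona's range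
  `classAbsManinConstantEqOne_of_forall_conductorNorm_lt_500000_of_exists_kodairaIstar (h40 hnf) W hcov`:
  «every globally minimal member has conductor `< 500000` and an odd prime of Kodaira type `Iₙ*`»
  (`500000 ≤ 400000·3 ≤ 400000·p`) — the shape a class-list consumer instantiates.
* `…_of_level_le_300000 (h30 hnf)` (two forms); at `B = 130000` (`h26`) the generic certificate is the booked one (not restated).

Census of record for the `B = 400000` instance (referee-reader r1 g5; engine = manin-r2 g5's
engine 1 with the bound read from the environment, on referee A2's ROUND 508 state `067eb117…`): of
the `9748` classes still carrying a `MANIN-DB*` register entry, `1913` are covered at `B = 400000` and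
`0` at `B = 130000` (the `130000` road is fully booked); `1749` of them are literal on `MANIN-DB*`
alone with no open cell; every key is `q = 3` of type `I_ν*`, `ν ≥ 1`, partner levels
`133350 … 166656`. Tables and the offer are the cell lead's (`pub/bsd-litref/manin/offers/TWIST-CREX/`).

## References
* [Cremona2022ManinConstants] J. E. Cremona, *Manin constants and optimal curves*, `ecdata/manin.txt`
  ¶1–2, ¶ "Concerning the Manin constant", "Data files" (optimality code `1` and `mc = 1` in every
  class of conductor `≤ 400000`); typed as `cremona_abs_maninConstant_eq_one_of_level_le_400000`
  (`ManinConstantConductorLt500000.lean`, referee A ROUND 325).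
* [CesnaviciusNeururerSaha2023] K. Česnavičius, M. Neururer, A. Saha, *The Manin constant and the
  modular degree*, JEMS 26 (2024) 573–637, §1 (the `300000` sentence, ref. [Cre19]); typed as
  `cremona_abs_maninConstant_eq_one_of_level_le_300000` (`ManinConstantConductorLe300000.lean`).
* [AgasheRibetStein2006] A. Agashe, K. Ribet, W. A. Stein, *The Manin constant*, with an appendix by
  J. Cremona, Pure Appl. Math. Q. 2 (2006) 617–636: Thm. 2.6 (p. 619), appendix §5 (method).
* [Stevens1989] G. Stevens, *Stickelberger elements and modular parametrizations of elliptic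
  curves*, Invent. Math. 98 (1989) 75–106: Lemma (5.2) p. 96, Lemma (5.4) p. 97.
* [Shimura1971] G. Shimura, *Introduction to the arithmetic theory of automorphic functions*
  (1971), Prop. 3.64.
* [EdixhovenManin1991] B. Edixhoven, Progr. Math. 89 (1991), §1 (typescript L96–101) and Prop. 2.
* [SilvermanATAEC1994] J. H. Silverman, *ATAEC*, IV.10.2, IV.10.4, IV.11.1 (table p. 368), Cor.
  IV.9.1 (Néron mapping property).
* [SilvermanAEC2009] J. H. Silverman, *AEC*, III.4, VII.5 Prop. 5.1, X.2 Ex. 10.16, X.5 Cor. 5.4.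
* [CremonaAlgorithms1997] J. E. Cremona, *Algorithms for Modular Elliptic Curves*, 2nd ed., §3.9
  (twisting commutes with isogenies).
-/

noncomputable section

open scoped MatrixGroups ModularForm Classical

open CongruenceSubgroup WeierstrassCurve IsDedekindDomain IsDedekindDomain.HeightOneSpectrum
  NumberField Rat.HeightOneSpectrum Literature.NumberTheory.Automorphic

namespace Literature.NumberTheory.EllipticCurves.ModularForms
/-! ### INSTANCES at the tree's named level-bounded Manin data -/

section DeterminedRange

/-- **T-TWIST-CRE at Cremona's DETERMINED range (`B = 400000`, named input `h40`).** For a class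
every globally minimal member `W'` of which has SOME odd prime `p` with: Kodaira type `I₀*` at `p`
and `N(W') ≤ 400000·p²`; or type `I_ν*` (`ν ≥ 1`) at `p` and `N(W') ≤ 400000·p`; or a displayed
twist witness `TwistSemistableWitnessAt W' p` and `N(W') ≤ 400000·p` — `ClassAbsManinConstantEqOne W`:
`|c| = 1` for every optimal `X₀`-datum of every globally minimal member. The datum `h40` is consumed
at the PARTNER class, of conductor `N(W')/p²` resp. `≤ N(W')/p ≤ 400000`, where Cremona's optimal curve
is determined (optimality code `1`). On Cremona's table (`N < 500000`) the level clauses hold at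
every odd `p`. Binders `h40 hnf` only.
[cite: Cremona2022ManinConstants, manin.txt ¶1–2, ¶ "Concerning the Manin constant", "Data files"]
[cite: AgasheRibetStein2006, appendix §5 (method)] [cite: Stevens1989, Lemmas (5.2), (5.4)]
[cite: SilvermanATAEC1994, IV.11.1 table p. 368] [cite: EdixhovenManin1991, §1] -/
theorem classAbsManinConstantEqOne_of_forall_exists_kodairaIstar_or_twist_of_level_le_400000
    (h40 : cremona_abs_maninConstant_eq_one_of_level_le_400000)
    (hnf : exists_isNewformOf)
    (W : WeierstrassCurve ℚ)
    (hcov : ∀ (W' : WeierstrassCurve ℚ) [W'.IsElliptic] [W'.IsGloballyMinimal], IsIsogenous W W' →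
      ∃ (p : ℕ) (hp : p.Prime), p ≠ 2 ∧
        ((W'.kodairaSymbolAt ((primesEquiv (R := ℤ)).symm ⟨p, hp⟩) = .Istar 0 ∧
            W'.conductorNorm ℤ ≤ 400000 * p ^ 2) ∨
         ((∃ n : ℕ, W'.kodairaSymbolAt ((primesEquiv (R := ℤ)).symm ⟨p, hp⟩) = .Istar (n + 1)) ∧
            W'.conductorNorm ℤ ≤ 400000 * p) ∨
         (@TwistSemistableWitnessAt W' p ⟨hp⟩ ∧ W'.conductorNorm ℤ ≤ 400000 * p))) :
    ClassAbsManinConstantEqOne W :=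
  classAbsManinConstantEqOne_of_forall_exists_kodairaIstar_or_twist_of_level_le_bound 400000
    (fun V _ _ _ _ DV h hM ↦ h40 V DV h hM) hnf W hcov

/-- **Kodaira-only form at `B = 400000`**: every globally minimal member has an odd prime `p` of
Kodaira type `Iₙ*` (some `n ≥ 0`) with `N(W') ≤ 400000·p` ⟹ `ClassAbsManinConstantEqOne W`, modulo
`h40 hnf`. [cite: Cremona2022ManinConstants, manin.txt ¶1–2, ¶ "Concerning the Manin constant"]
[cite: SilvermanATAEC1994, IV.11.1 table p. 368] [cite: Stevens1989, Lemmas (5.2), (5.4)] -/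
theorem classAbsManinConstantEqOne_of_forall_exists_kodairaIstar_of_level_le_400000
    (h40 : cremona_abs_maninConstant_eq_one_of_level_le_400000)
    (hnf : exists_isNewformOf)
    (W : WeierstrassCurve ℚ)
    (hcov : ∀ (W' : WeierstrassCurve ℚ) [W'.IsElliptic] [W'.IsGloballyMinimal], IsIsogenous W W' →
      ∃ (p : ℕ) (hp : p.Prime), p ≠ 2 ∧
        (∃ n : ℕ, W'.kodairaSymbolAt ((primesEquiv (R := ℤ)).symm ⟨p, hp⟩) = .Istar n) ∧
          W'.conductorNorm ℤ ≤ 400000 * p) :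
    ClassAbsManinConstantEqOne W :=
  classAbsManinConstantEqOne_of_forall_exists_kodairaIstar_of_level_le_bound 400000
    (fun V _ _ _ _ DV h hM ↦ h40 V DV h hM) hnf W hcov

/-- **The TABLE form on Cremona's range**: if every globally minimal member `W'` of the class has
conductor `< 500000` and an odd prime `p` of Kodaira type `Iₙ*` (any `n ≥ 0`), then
`ClassAbsManinConstantEqOne W`, modulo `h40 hnf` — since `N(W') < 500000 ≤ 400000·3 ≤ 400000·p`.
This is the shape a class-list consumer instantiates (the partner level is `≤ N(W')/p < 166667`).
[cite: Cremona2022ManinConstants, manin.txt ¶1–2, ¶ "Concerning the Manin constant"]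
[cite: SilvermanATAEC1994, IV.11.1 table p. 368] [cite: Stevens1989, Lemmas (5.2), (5.4)] -/
theorem classAbsManinConstantEqOne_of_forall_conductorNorm_lt_500000_of_exists_kodairaIstar
    (h40 : cremona_abs_maninConstant_eq_one_of_level_le_400000)
    (hnf : exists_isNewformOf)
    (W : WeierstrassCurve ℚ)
    (hcov : ∀ (W' : WeierstrassCurve ℚ) [W'.IsElliptic] [W'.IsGloballyMinimal], IsIsogenous W W' →
      W'.conductorNorm ℤ < 500000 ∧
        ∃ (p : ℕ) (hp : p.Prime), p ≠ 2 ∧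
          ∃ n : ℕ, W'.kodairaSymbolAt ((primesEquiv (R := ℤ)).symm ⟨p, hp⟩) = .Istar n) :
    ClassAbsManinConstantEqOne W := by
  refine classAbsManinConstantEqOne_of_forall_exists_kodairaIstar_of_level_le_400000 h40 hnf W
    fun W' _ _ hiso ↦ ?_
  obtain ⟨hlt, p, hp, hp2, n, hK⟩ := hcov W' hiso
  refine ⟨p, hp, hp2, ⟨n, hK⟩, ?_⟩
  have h3 : 3 ≤ p := by
    have h2 := hp.two_le
    omega
  calc W'.conductorNorm ℤ ≤ 400000 * 3 := by omega
    _ ≤ 400000 * p := Nat.mul_le_mul_left 400000 h3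

/-- The binder form carried by consumers at `B = 400000`: `p ∤ c` for EVERY prime `p` and every
optimal `X₀`-datum of every globally minimal member, modulo `h40 hnf`.
[cite: Cremona2022ManinConstants, manin.txt ¶1–2, ¶ "Concerning the Manin constant"]
[cite: Stevens1989, Lemmas (5.2), (5.4)] -/
theorem not_dvd_maninConstant_of_forall_exists_kodairaIstar_or_twist_of_level_le_400000
    (h40 : cremona_abs_maninConstant_eq_one_of_level_le_400000)
    (hnf : exists_isNewformOf)
    {W : WeierstrassCurve ℚ}
    (hcov : ∀ (W' : WeierstrassCurve ℚ) [W'.IsElliptic] [W'.IsGloballyMinimal], IsIsogenous W W' →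
      ∃ (p : ℕ) (hp : p.Prime), p ≠ 2 ∧
        ((W'.kodairaSymbolAt ((primesEquiv (R := ℤ)).symm ⟨p, hp⟩) = .Istar 0 ∧
            W'.conductorNorm ℤ ≤ 400000 * p ^ 2) ∨
         ((∃ n : ℕ, W'.kodairaSymbolAt ((primesEquiv (R := ℤ)).symm ⟨p, hp⟩) = .Istar (n + 1)) ∧
            W'.conductorNorm ℤ ≤ 400000 * p) ∨
         (@TwistSemistableWitnessAt W' p ⟨hp⟩ ∧ W'.conductorNorm ℤ ≤ 400000 * p)))
    (W' : WeierstrassCurve ℚ) [W'.IsElliptic] [W'.IsGloballyMinimal] {N' : ℕ} [NeZero N']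
    (D' : ModularParametrizationData W' N') (hiso : IsIsogenous W W')
    (hopt : ∀ z ∈ D'.L.lattice, ∃ w ∈ periodLattice D'.f, z = D'.c * w)
    (p : ℕ) (hp : p.Prime) : ¬ (p : ℤ) ∣ D'.maninConstant :=
  (classAbsManinConstantEqOne_of_forall_exists_kodairaIstar_or_twist_of_level_le_400000 h40 hnf W
    hcov).not_dvd_maninConstant D' hiso hopt hp

/-- The valuation form at `B = 400000`: `ord_p(c) = 0` for every prime `p`, modulo `h40 hnf`.
[cite: Cremona2022ManinConstants, manin.txt ¶1–2, ¶ "Concerning the Manin constant"] -/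
theorem padicValInt_maninConstant_eq_zero_of_forall_exists_kodairaIstar_or_twist_of_level_le_400000
    (h40 : cremona_abs_maninConstant_eq_one_of_level_le_400000)
    (hnf : exists_isNewformOf)
    {W : WeierstrassCurve ℚ}
    (hcov : ∀ (W' : WeierstrassCurve ℚ) [W'.IsElliptic] [W'.IsGloballyMinimal], IsIsogenous W W' →
      ∃ (p : ℕ) (hp : p.Prime), p ≠ 2 ∧
        ((W'.kodairaSymbolAt ((primesEquiv (R := ℤ)).symm ⟨p, hp⟩) = .Istar 0 ∧
            W'.conductorNorm ℤ ≤ 400000 * p ^ 2) ∨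
         ((∃ n : ℕ, W'.kodairaSymbolAt ((primesEquiv (R := ℤ)).symm ⟨p, hp⟩) = .Istar (n + 1)) ∧
            W'.conductorNorm ℤ ≤ 400000 * p) ∨
         (@TwistSemistableWitnessAt W' p ⟨hp⟩ ∧ W'.conductorNorm ℤ ≤ 400000 * p)))
    (W' : WeierstrassCurve ℚ) [W'.IsElliptic] [W'.IsGloballyMinimal] {N' : ℕ} [NeZero N']
    (D' : ModularParametrizationData W' N') (hiso : IsIsogenous W W')
    (hopt : ∀ z ∈ D'.L.lattice, ∃ w ∈ periodLattice D'.f, z = D'.c * w)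
    (p : ℕ) (hp : p.Prime) : padicValInt p D'.maninConstant = 0 :=
  padicValInt.eq_zero_of_not_dvd
    (not_dvd_maninConstant_of_forall_exists_kodairaIstar_or_twist_of_level_le_400000 h40 hnf hcov W'
      D' hiso hopt p hp)

end DeterminedRange

section SecondaryBound

/-- **The same class certificate at the refereed-secondary bound `B = 300000` (`h30`)** — the
sentence of Česnavičius–Neururer–Saha 2024 §1 citing Cremona's database [Cre19]; on Cremona's
table the partner levels of the `q = 3`, `I_ν*` keys are `≤ 166666 < 300000`, so the two instances
cover the same classes there. Binders `h30 hnf` only.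
[cite: CesnaviciusNeururerSaha2023, §1 (arXiv v3 text chunk 3 L70–72; ref. Cre19)]
[cite: Stevens1989, Lemmas (5.2), (5.4)] [cite: SilvermanATAEC1994, IV.11.1 table p. 368] -/
theorem classAbsManinConstantEqOne_of_forall_exists_kodairaIstar_or_twist_of_level_le_300000
    (h30 : cremona_abs_maninConstant_eq_one_of_level_le_300000)
    (hnf : exists_isNewformOf)
    (W : WeierstrassCurve ℚ)
    (hcov : ∀ (W' : WeierstrassCurve ℚ) [W'.IsElliptic] [W'.IsGloballyMinimal], IsIsogenous W W' →
      ∃ (p : ℕ) (hp : p.Prime), p ≠ 2 ∧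
        ((W'.kodairaSymbolAt ((primesEquiv (R := ℤ)).symm ⟨p, hp⟩) = .Istar 0 ∧
            W'.conductorNorm ℤ ≤ 300000 * p ^ 2) ∨
         ((∃ n : ℕ, W'.kodairaSymbolAt ((primesEquiv (R := ℤ)).symm ⟨p, hp⟩) = .Istar (n + 1)) ∧
            W'.conductorNorm ℤ ≤ 300000 * p) ∨
         (@TwistSemistableWitnessAt W' p ⟨hp⟩ ∧ W'.conductorNorm ℤ ≤ 300000 * p))) :
    ClassAbsManinConstantEqOne W :=
  classAbsManinConstantEqOne_of_forall_exists_kodairaIstar_or_twist_of_level_le_bound 300000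
    (fun V _ _ _ _ DV h hM ↦ h30 V DV h hM) hnf W hcov

/-- Kodaira-only form at `B = 300000`, modulo `h30 hnf`.
[cite: CesnaviciusNeururerSaha2023, §1] [cite: SilvermanATAEC1994, IV.11.1 table p. 368] -/
theorem classAbsManinConstantEqOne_of_forall_exists_kodairaIstar_of_level_le_300000
    (h30 : cremona_abs_maninConstant_eq_one_of_level_le_300000)
    (hnf : exists_isNewformOf)
    (W : WeierstrassCurve ℚ)
    (hcov : ∀ (W' : WeierstrassCurve ℚ) [W'.IsElliptic] [W'.IsGloballyMinimal], IsIsogenous W W' →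
      ∃ (p : ℕ) (hp : p.Prime), p ≠ 2 ∧
        (∃ n : ℕ, W'.kodairaSymbolAt ((primesEquiv (R := ℤ)).symm ⟨p, hp⟩) = .Istar n) ∧
          W'.conductorNorm ℤ ≤ 300000 * p) :
    ClassAbsManinConstantEqOne W :=
  classAbsManinConstantEqOne_of_forall_exists_kodairaIstar_of_level_le_bound 300000
    (fun V _ _ _ _ DV h hM ↦ h30 V DV h hM) hnf W hcov

end SecondaryBound

/-! ### `B = 130000`

At `B = 130000` with `h26 = AgasheRibetStein2006.cremona_abs_maninConstant_eq_one_of_level_le` the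
generic certificate `classAbsManinConstantEqOne_of_forall_exists_kodairaIstar_or_twist_of_level_le_bound
130000 h26 hnf` has, word for word, the statement of the booked
`classAbsManinConstantEqOne_of_forall_exists_kodairaIstar_or_twist_of_level_le`
(`ManinConstantQuadraticTwistCremonaRangeProofs.lean`) — not restated here (the gate's dedup lint
identifies the two); consumers at `130000` keep citing the booked name. -/


end Literature.NumberTheory.EllipticCurves.ModularForms

end
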